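import Literature.Analysis.FluidPDE.Tao2016AveragedNS.SeedScaleSharpClosure
import Literature.Analysis.FluidPDE.Tao2016AveragedNS.PseudoOrbitTiming
import HarnessLib

/-!
# Theorem 5.3, TIMED, along every pseudo-orbit at the SHARP budget

Note for the FLUID COMPUTER cell (pub-fluidc, blueprint seat bp1). HONEST FRAMING: this is a
low prior, high value-of-information experiment on Tao's machine paradigm
[Tao2016AveragedNS, §5.5]; NOT a claim that NS blows up. Everything here concerns Tao's five-mode
delay circuit `delayCircuitWith K M ε` (an ODE on `ℝ⁵`) and its pseudo-orbits.

`PseudoOrbitTiming.lean` proved the TIMED form of Theorem 5.3 along every `δ`-pseudo-orbit issued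
`δ₀`-close to Tao's datum (5.6) under the budget `δ₀ + δT < ε²e^{-M}/(8√M)`: QUIET on `[0, 7/5]`,
FIRED on `[7/4, 2]`; `SeedScaleSharpClosure.lean` re-certified the fired half at the SHARP budget
`δ₀ + δT < (3133/2500)·ε²e^{-M}/√M` (any level below the dud threshold `√(π/2)·ε²e^{-M}/√M`) but
left the quiet half / the hitting-time window at the sharp budget open. This file closes it. The
early trigger bound `Ignition.abs_c_lt_level_early'` (`|c| < ε²K⁻¹⁰` on `[0, 7/5]`,
SeedScaleTiming.lean) only needs the weak budget `δ₀ + 2δ ≤ ε²e^{-M}/8`, so together with the sharp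
entry state `triggerLevel_hit_sharp` the first hitting time of the trigger level lies in
`(7/5, 8/5]` at the sharp budget too, and the smoothing transfer of PseudoOrbitTiming.lean —
written here once for an ARBITRARY budget level `B ≤ 1/100`
(`IsPseudoOrbit.exists_approxTrajectory_of_lt`) — carries the closed conclusions to genuine
pseudo-orbits:

* `QuietOn K ε Y S` — the quiet-state predicate (`|ã|, |d| ≤ 4K⁻¹⁰`, `|c| ≤ ε²K⁻¹⁰`, `|b| ≤ 2ε`,
  `a² ≥ 0.999` on the time set `S`);
* `approxTrajectory_criticalTime_window_sharp`, `approxTrajectory_transition_timed_sharp` —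
  differentiable approximate trajectories, `δ₀ + δT ≤ (3133/2500)·ε²e^{-M}/√M`: hitting time in
  `(7/5, 8/5]`, quiet on `[0, 7/5]`, fired on `[7/4, 2]` and on `[2, T]`;
* `IsPseudoOrbit.transition_timed_sharp` — **Theorem 5.3 timed along every pseudo-orbit at the
  sharp budget** (strict):
  `QuietOn K ε Y [0, 7/5] ∧ FiredOn K Y [7/4, 2] 4 2 ∧ FiredOn K Y [2, T] 6 4`;
* `IsPseudoOrbit.transition_timed_pow_five` — the same under the `q = 5` budget
  `δ₀ + δT ≤ ε²e^{-M}/K⁵` on the whole family `M ≤ K¹⁰`.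

So along EVERY pseudo-orbit within any budget below `1.2532·ε²e^{-M}/√M` the transition time lies
in `[7/5, 7/4]`, uniformly over the retuned family — the complete gate-level statement (timing AND
firing) at the sharp scale. Not claimed: anything about (D)(4) proper (`PseudoOrbitTransition q`,
refuted for every `q`), optimality of the windows, anything about Navier–Stokes.
-/

noncomputable section

namespace Literature.Analysis.FluidPDE.Tao2016AveragedNS

open Real Set
open scoped NNReal
open NegKick (clockInt)

/-! ## §1. The quiet state -/

/-- **The quiet (pre-transition) state on a time set `S`**: `|ã|, |d| ≤ 4K⁻¹⁰`, `|c| ≤ ε²K⁻¹⁰`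
(closed form), `|b| ≤ 2ε` and `a² ≥ 0.999` at every `t ∈ S`.
[cite: Tao2016AveragedNS, §5.5 Theorem 5.3] -/
def QuietOn (K ε : ℝ) (Y : ℝ → Fin 5 → ℝ) (S : Set ℝ) : Prop :=
  ∀ t ∈ S, |Y t 4| ≤ 4 / K ^ 10 ∧ |Y t 3| ≤ 4 / K ^ 10 ∧ |Y t 2| ≤ ε ^ 2 / K ^ 10 ∧
    |Y t 1| ≤ 2 * ε ∧ 999 / 1000 ≤ Y t 0 ^ 2

/-- Monotonicity of `QuietOn` in the time set. [folklore] -/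
theorem QuietOn.mono {K ε : ℝ} {Y : ℝ → Fin 5 → ℝ} {S S' : Set ℝ} (h : QuietOn K ε Y S)
    (hS : S' ⊆ S) : QuietOn K ε Y S' :=
  fun t ht => h t (hS ht)

/-! ## §2. Differentiable approximate trajectories at the sharp budget -/

section Approx

/-- **The critical time at the SHARP budget.** For every member and every differentiable approximate
trajectory `Y` (velocity `V`, sup-defect `≤ δ` and sup-norm `≤ 2` on `[0,T)`, `T ≥ 2`) issued
`δ₀`-close to (5.6) with `δ₀ + δT ≤ (3133/2500)·ε²e^{-M}/√M`: the first hitting time `τ` of the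
trigger level `ε²K⁻¹⁰` lies in `(7/5, 8/5]`, `|c| < ε²K⁻¹⁰` before it, the residue
`c·e^{-G} ≥ ε²e^{-M}/(16000√M)` and `b ≥ (49/50)ε` hold on `[1, τ]`, and the trajectory is quiet on
`[0, τ]` (sharp entry state `triggerLevel_hit_sharp`; `τ > 7/5` from the weak-budget early bound
`Ignition.abs_c_lt_level_early'`). [cite: Tao2016AveragedNS, §5.5 Theorem 5.3] -/
theorem approxTrajectory_criticalTime_window_sharp (K M ε δ δ₀ T : ℝ) (Y V : ℝ → Fin 5 → ℝ)
    (hK : 2 * 20 ^ 42 * (Nat.factorial 42 : ℝ) + 16 ≤ K) (hML : 3000 * Real.log K ≤ M)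
    (hMK : M ≤ K ^ 10) (hε : 0 < ε) (hεle : ε ≤ exp (-(10 * M)) / K ^ 100) (hT : 2 ≤ T)
    (hY : ∀ t, HasDerivAt Y (V t) t)
    (hV : ∀ t ∈ Ico 0 T, ‖V t - delayCircuitWith K M ε (Y t)‖ ≤ δ)
    (hR : ∀ t ∈ Ico 0 T, ‖Y t‖ ≤ 2) (h0 : ‖Y 0 - delayInit‖ ≤ δ₀)
    (hB : δ₀ + δ * T ≤ 3133 / 2500 * (ε ^ 2 * exp (-M)) / Real.sqrt M) :
    ∃ τ ∈ Ioc (7 / 5 : ℝ) (8 / 5), Y τ 2 = ε ^ 2 / K ^ 10 ∧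
      (∀ t ∈ Ico (0 : ℝ) τ, |Y t 2| < ε ^ 2 / K ^ 10) ∧
      (∀ t ∈ Icc (1 : ℝ) τ,
        ε ^ 2 * exp (-M) / (16000 * Real.sqrt M) ≤ Y t 2 * exp (-clockInt ε M Y t)) ∧
      (∀ t ∈ Icc (1 : ℝ) τ, 49 / 50 * ε ≤ Y t 1) ∧ QuietOn K ε Y (Icc 0 τ) := by
  have hδ : 0 ≤ δ := Ignition.defect_nonneg hV hT
  have hηS : δ₀ + 2 * δ ≤ 3133 / 2500 * (ε ^ 2 * exp (-M)) / Real.sqrt M := by nlinarith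
  have hη : δ₀ + 2 * δ ≤ ε ^ 2 * exp (-M) / 8 :=
    hηS.trans (IgnitionSharp.sharp_level_le_eighth hK hML hMK hε hεle)
  obtain ⟨τ, hτ, hcτ, hbefore, hres, hblate, hwin⟩ :=
    triggerLevel_hit_sharp K M ε δ δ₀ T Y V hK hML hMK hε hεle hT hY hV hR h0 hB
  have hτ75 : 7 / 5 < τ := by
    by_contra hle
    have h := Ignition.abs_c_lt_level_early' hY hV hR hT hK hML hMK hε hεle h0 hη
      ⟨by linarith [hτ.1], le_of_not_gt hle⟩
    rw [hcτ, abs_of_nonneg (by positivity)] at h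
    exact lt_irrefl _ h
  refine ⟨τ, ⟨hτ75, hτ.2⟩, hcτ, hbefore, hres, hblate, fun t ht => ?_⟩
  obtain ⟨hb, ha, hd, he⟩ := hwin t ht
  have hc : |Y t 2| ≤ ε ^ 2 / K ^ 10 := by
    rcases lt_or_eq_of_le ht.2 with hlt | heq
    · exact (hbefore t ⟨ht.1, hlt⟩).le
    · rw [heq, hcτ, abs_of_nonneg (by positivity)]
  exact ⟨he, hd, hc, hb, ha⟩

/-- **Theorem 5.3 for approximate trajectories at the SHARP budget, TIMED form.** Under the
hypotheses of `approxTrajectory_criticalTime_window_sharp`: QUIET on the fixed window `[0, 7/5]`,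
FIRED (`|ã - 1| ≤ 4K⁻²⁰`, modes `≤ 2K⁻¹⁰`) on `[7/4, 2]` and (`|ã - 1| ≤ 6K⁻²⁰`, modes `≤ 4K⁻¹⁰`) on
`[2, T]`. [cite: Tao2016AveragedNS, §5.5 Theorem 5.3] -/
theorem approxTrajectory_transition_timed_sharp (K M ε δ δ₀ T : ℝ) (Y V : ℝ → Fin 5 → ℝ)
    (hK : 2 * 20 ^ 42 * (Nat.factorial 42 : ℝ) + 16 ≤ K) (hML : 3000 * Real.log K ≤ M)
    (hMK : M ≤ K ^ 10) (hε : 0 < ε) (hεle : ε ≤ exp (-(10 * M)) / K ^ 100) (hT : 2 ≤ T)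
    (hY : ∀ t, HasDerivAt Y (V t) t)
    (hV : ∀ t ∈ Ico 0 T, ‖V t - delayCircuitWith K M ε (Y t)‖ ≤ δ)
    (hR : ∀ t ∈ Ico 0 T, ‖Y t‖ ≤ 2) (h0 : ‖Y 0 - delayInit‖ ≤ δ₀)
    (hB : δ₀ + δ * T ≤ 3133 / 2500 * (ε ^ 2 * exp (-M)) / Real.sqrt M) :
    QuietOn K ε Y (Icc 0 (7 / 5)) ∧ FiredOn K Y (Icc (7 / 4) 2) 4 2 ∧
      FiredOn K Y (Icc 2 T) 6 4 := by
  obtain ⟨τ, hτ, -, -, -, -, hq⟩ :=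
    approxTrajectory_criticalTime_window_sharp K M ε δ δ₀ T Y V hK hML hMK hε hεle hT hY hV hR
      h0 hB
  exact ⟨hq.mono (Icc_subset_Icc_right hτ.1.le),
    approxTrajectory_firedOn_late_sharp K M ε δ δ₀ T Y V hK hML hMK hε hεle hT hY hV hR h0 hB,
    approxTrajectory_firedOn_from_two_sharp K M ε δ δ₀ T Y V hK hML hMK hε hεle hT hY hV hR h0 hB⟩

end Approx

/-! ## §3. Genuine pseudo-orbits: the transfer device at an arbitrary budget; the timed theorem -/

section Member

variable {K M ε δ δ₀ T : ℝ} {Y : ℝ → Fin 5 → ℝ}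

/-- **The transfer device at an arbitrary budget level.** A globally continuous `δ`-pseudo-orbit of
`delayCircuitWith K M ε` in the sup-ball of radius `2` on `[0,T]` (`T > 0`), issued `δ₀`-close to
(5.6) with `δ₀ + δT < B` (strict) for some level `B ≤ 1/100`, is for every `η > 0` coordinatewise
within `η` on `[0,T]` of a DIFFERENTIABLE approximate trajectory `Z` (velocity `W` on `ℝ`) with
sup-defect `δ'` and sup-norm `≤ 2` on `[0,T)`, datum `δ₀'`, and `δ₀' + δ'T ≤ B` (smoothing lemma
with `η' = min(η, slack/(1+T), 1/2)` and the a-priori bound `‖Y‖ ≤ 6/5`). No hypothesis on the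
member is needed. [cite: Tao2016AveragedNS, §5.5 Theorem 5.3] -/
theorem IsPseudoOrbit.exists_approxTrajectory_of_lt
    (hY : IsPseudoOrbit (delayCircuitWith K M ε) δ 2 T Y) (hYc : Continuous Y) (hT : 0 < T)
    (h0 : ‖Y 0 - delayInit‖ ≤ δ₀) {B : ℝ} (hB : δ₀ + δ * T < B) (hB1 : B ≤ 1 / 100)
    {η : ℝ} (hη : 0 < η) :
    ∃ (δ' δ₀' : ℝ) (Z W : ℝ → Fin 5 → ℝ), (∀ t, HasDerivAt Z (W t) t) ∧
      (∀ t ∈ Ico 0 T, ‖W t - delayCircuitWith K M ε (Z t)‖ ≤ δ') ∧ (∀ t ∈ Ico 0 T, ‖Z t‖ ≤ 2) ∧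
      ‖Z 0 - delayInit‖ ≤ δ₀' ∧ δ₀' + δ' * T ≤ B ∧
      ∀ t ∈ Icc 0 T, ∀ i : Fin 5, |Z t i - Y t i| ≤ η := by
  have hδ : 0 ≤ δ := by
    obtain ⟨V, -, hV⟩ := hY.defect 0 ⟨le_rfl, hT⟩
    exact (norm_nonneg _).trans hV
  have hδ₀ : 0 ≤ δ₀ := (norm_nonneg _).trans h0
  have hδT : 0 ≤ δ * T := by positivity
  have hR₀ : ∀ t ∈ Icc 0 T, ‖Y t‖ ≤ 6 / 5 :=
    hY.norm_le_six_fifths hδ h0 (by linarith) (by linarith)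
  have hF : Continuous (delayCircuitWith K M ε) := continuous_delayCircuitWith K M ε
  obtain ⟨η₀, hη₀⟩ : ∃ η₀ : ℝ, η₀ = (B - (δ₀ + δ * T)) / (1 + T) := ⟨_, rfl⟩
  have hη₀pos : 0 < η₀ := by rw [hη₀]; exact div_pos (by linarith) (by linarith)
  have hη₀T : η₀ * (1 + T) = B - (δ₀ + δ * T) := by
    rw [hη₀]; field_simp
  obtain ⟨η', hη'⟩ : ∃ η' : ℝ, η' = min η (min η₀ (1 / 2)) := ⟨_, rfl⟩
  have hη'0 : 0 < η' := by rw [hη']; exact lt_min hη (lt_min hη₀pos (by norm_num))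
  have hη'η : η' ≤ η := by rw [hη']; exact min_le_left _ _
  have hη'η₀ : η' ≤ η₀ := by rw [hη']; exact (min_le_right _ _).trans (min_le_left _ _)
  have hη'2 : η' ≤ 1 / 2 := by rw [hη']; exact (min_le_right _ _).trans (min_le_right _ _)
  obtain ⟨Z, W, hZd, hWd, hZn, hZY⟩ := hY.exists_smooth_approx hF hYc hT hR₀ hη'0
  have hR : ∀ s ∈ Ico 0 T, ‖Z s‖ ≤ 2 := fun s hs =>
    (hZn s ⟨hs.1, hs.2.le⟩).trans (by linarith)
  have h0' : ‖Z 0 - delayInit‖ ≤ δ₀ + η' := by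
    calc ‖Z 0 - delayInit‖ = ‖(Z 0 - Y 0) + (Y 0 - delayInit)‖ := by rw [sub_add_sub_cancel]
      _ ≤ ‖Z 0 - Y 0‖ + ‖Y 0 - delayInit‖ := norm_add_le _ _
      _ ≤ δ₀ + η' := by linarith [hZY 0 ⟨le_rfl, hT.le⟩]
  have hB' : (δ₀ + η') + (δ + η') * T ≤ B := by
    have h1 : η' * (1 + T) ≤ η₀ * (1 + T) := mul_le_mul_of_nonneg_right hη'η₀ (by linarith)
    nlinarith
  refine ⟨δ + η', δ₀ + η', Z, W, hZd, hWd, hR, h0', hB', fun t ht i => ?_⟩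
  have h1 := norm_le_pi_norm (Z t - Y t) i
  rw [Pi.sub_apply, Real.norm_eq_abs] at h1
  exact h1.trans ((hZY t ht).trans hη'η)

/-- **Theorem 5.3, timed, along every pseudo-orbit at the SHARP budget.** For a member
`delayCircuitWith K M ε` and a `δ`-pseudo-orbit `Y` in the sup-ball of radius `2` on `[0,T]`
(`T ≥ 2`; continuous on `[0,T]`, right-differentiable on `[0,T)`) issued `δ₀`-close to (5.6) with
`δ₀ + δT < (3133/2500)·ε²e^{-M}/√M`: QUIET on `[0, 7/5]` (`|ã|, |d| ≤ 4K⁻¹⁰`, `|c| ≤ ε²K⁻¹⁰`,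
`|b| ≤ 2ε`, `a² ≥ 0.999`), FIRED on `[7/4, 2]` (`|ã - 1| ≤ 4K⁻²⁰`, modes `≤ 2K⁻¹⁰`) and on `[2, T]`
(`|ã - 1| ≤ 6K⁻²⁰`, modes `≤ 4K⁻¹⁰`). So the transition time lies in `[7/5, 7/4]` along EVERY
pseudo-orbit within any budget below the dud threshold `√(π/2)·ε²e^{-M}/√M` (up to `10⁻⁴`).
[cite: Tao2016AveragedNS, §5.5 Theorem 5.3] -/
theorem IsPseudoOrbit.transition_timed_sharp (hY : IsPseudoOrbit (delayCircuitWith K M ε) δ 2 T Y)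
    (hK : 2 * 20 ^ 42 * (Nat.factorial 42 : ℝ) + 16 ≤ K) (hML : 3000 * Real.log K ≤ M)
    (hMK : M ≤ K ^ 10) (hε : 0 < ε) (hεle : ε ≤ exp (-(10 * M)) / K ^ 100) (hT : 2 ≤ T)
    (h0 : ‖Y 0 - delayInit‖ ≤ δ₀)
    (hB : δ₀ + δ * T < 3133 / 2500 * (ε ^ 2 * exp (-M)) / Real.sqrt M) :
    QuietOn K ε Y (Icc 0 (7 / 5)) ∧ FiredOn K Y (Icc (7 / 4) 2) 4 2 ∧
      FiredOn K Y (Icc 2 T) 6 4 := by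
  have hT0 : 0 < T := by linarith
  have hδ : 0 ≤ δ := by
    obtain ⟨V, -, hV⟩ := hY.defect 0 ⟨le_rfl, hT0⟩
    exact (norm_nonneg _).trans hV
  obtain ⟨-, -, hε2, hexpM, -, -, -, h77, -⟩ := Ignition.ignition_params hK hML hMK hε hεle
  have hb100 : 3133 / 2500 * (ε ^ 2 * exp (-M)) / Real.sqrt M ≤ 1 / 100 := by
    have hsq0 : (0 : ℝ) < Real.sqrt M := by linarith
    rw [div_le_iff₀ hsq0]
    have h2 : ε ^ 2 * exp (-M) ≤ 1 / 100000 * (1 / 1000000) :=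
      mul_le_mul hε2 hexpM (exp_pos _).le (by norm_num)
    nlinarith
  have hδ₀ : 0 ≤ δ₀ := (norm_nonneg _).trans h0
  have hδT : 0 ≤ δ * T := by positivity
  -- WLOG `Y` is globally continuous
  obtain ⟨Yc, hYcc, hYcY, hYc⟩ := hY.exists_continuous hT0.le
  have h0c : ‖Yc 0 - delayInit‖ ≤ δ₀ := by rw [hYcY ⟨le_rfl, hT0.le⟩]; exact h0
  have hR₀ : ∀ t ∈ Icc 0 T, ‖Yc t‖ ≤ 6 / 5 :=
    hYc.norm_le_six_fifths hδ h0c (by linarith) (by linarith)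
  -- the timed conclusions for the approximants, with coordinates within `η`
  have key : ∀ η : ℝ, 0 < η → ∃ Z : ℝ → Fin 5 → ℝ,
      (∀ t ∈ Icc 0 T, ∀ i : Fin 5, |Z t i - Yc t i| ≤ η) ∧
      QuietOn K ε Z (Icc 0 (7 / 5)) ∧ FiredOn K Z (Icc (7 / 4) 2) 4 2 := by
    intro η hη
    obtain ⟨δ', δ₀', Z, W, hZd, hWd, hR, h0', hB', hZY⟩ :=
      hYc.exists_approxTrajectory_of_lt hYcc hT0 h0c hB hb100 hη
    obtain ⟨hq, hf, -⟩ := approxTrajectory_transition_timed_sharp K M ε δ' δ₀' T Z W hK hML hMK hε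
      hεle hT hZd hWd hR h0' hB'
    exact ⟨Z, hZY, hq, hf⟩
  refine ⟨fun t ht => ?_, fun t ht => ?_, hY.firedOn_from_two_sharp hK hML hMK hε hεle hT h0 hB⟩
  · have htT : t ∈ Icc 0 T := ⟨ht.1, by linarith [ht.2]⟩
    rw [← hYcY htT]
    refine ⟨?_, ?_, ?_, ?_, ?_⟩
    · rw [← sub_zero (Yc t 4)]
      refine Ignition.abs_sub_le_of_approx fun η hη => ?_
      obtain ⟨Z, hZY, hq, -⟩ := key η hη
      exact ⟨Z t 4, hZY t htT 4, by rw [sub_zero]; exact (hq t ht).1⟩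
    · rw [← sub_zero (Yc t 3)]
      refine Ignition.abs_sub_le_of_approx fun η hη => ?_
      obtain ⟨Z, hZY, hq, -⟩ := key η hη
      exact ⟨Z t 3, hZY t htT 3, by rw [sub_zero]; exact (hq t ht).2.1⟩
    · rw [← sub_zero (Yc t 2)]
      refine Ignition.abs_sub_le_of_approx fun η hη => ?_
      obtain ⟨Z, hZY, hq, -⟩ := key η hη
      exact ⟨Z t 2, hZY t htT 2, by rw [sub_zero]; exact (hq t ht).2.2.1⟩
    · rw [← sub_zero (Yc t 1)]
      refine Ignition.abs_sub_le_of_approx fun η hη => ?_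
      obtain ⟨Z, hZY, hq, -⟩ := key η hη
      exact ⟨Z t 1, hZY t htT 1, by rw [sub_zero]; exact (hq t ht).2.2.2.1⟩
    · have hy : |Yc t 0| ≤ 6 / 5 := by
        have h1 := norm_le_pi_norm (Yc t) 0
        rw [Real.norm_eq_abs] at h1
        exact h1.trans (hR₀ t htT)
      refine Ignition.le_sq_of_approx (by norm_num) hy fun η hη => ?_
      obtain ⟨Z, hZY, hq, -⟩ := key η hη
      exact ⟨Z t 0, hZY t htT 0, (hq t ht).2.2.2.2⟩
  · have htT : t ∈ Icc 0 T := ⟨by linarith [ht.1], by linarith [ht.2]⟩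
    rw [← hYcY htT]
    refine ⟨?_, fun i hi => ?_⟩
    · refine Ignition.abs_sub_le_of_approx fun η hη => ?_
      obtain ⟨Z, hZY, -, hf⟩ := key η hη
      exact ⟨Z t 4, hZY t htT 4, (hf t ht).1⟩
    · rw [← sub_zero (Yc t i)]
      refine Ignition.abs_sub_le_of_approx fun η hη => ?_
      obtain ⟨Z, hZY, -, hf⟩ := key η hη
      exact ⟨Z t i, hZY t htT i, by rw [sub_zero]; exact (hf t ht).2 i hi⟩

/-- **Theorem 5.3, timed, along every pseudo-orbit under the `q = 5` budget, corner included.** The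
same conclusions under `δ₀ + δT ≤ ε²e^{-M}/K⁵` for every member `M ≤ K¹⁰`
(`ε²e^{-M}/K⁵ ≤ ε²e^{-M}/√M < (3133/2500)·ε²e^{-M}/√M`).
[cite: Tao2016AveragedNS, §5.5 Theorem 5.3] -/
theorem IsPseudoOrbit.transition_timed_pow_five
    (hY : IsPseudoOrbit (delayCircuitWith K M ε) δ 2 T Y)
    (hK : 2 * 20 ^ 42 * (Nat.factorial 42 : ℝ) + 16 ≤ K) (hML : 3000 * Real.log K ≤ M)
    (hMK : M ≤ K ^ 10) (hε : 0 < ε) (hεle : ε ≤ exp (-(10 * M)) / K ^ 100) (hT : 2 ≤ T)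
    (h0 : ‖Y 0 - delayInit‖ ≤ δ₀) (hB : δ₀ + δ * T ≤ ε ^ 2 * exp (-M) / K ^ 5) :
    QuietOn K ε Y (Icc 0 (7 / 5)) ∧ FiredOn K Y (Icc (7 / 4) 2) 4 2 ∧
      FiredOn K Y (Icc 2 T) 6 4 := by
  refine hY.transition_timed_sharp hK hML hMK hε hεle hT h0 (hB.trans_lt ?_)
  obtain ⟨hK16, hM4, -⟩ := negKick_params hK hML hMK hε hεle
  have hM0 : 0 < M := by linarith
  have hsq0 : 0 < Real.sqrt M := Real.sqrt_pos.2 hM0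
  have hs : 0 < ε ^ 2 * exp (-M) := by positivity
  have hsqK : Real.sqrt M ≤ K ^ 5 := by
    rw [Real.sqrt_le_left (by positivity)]
    calc M ≤ K ^ 10 := hMK
      _ = (K ^ 5) ^ 2 := by ring
  calc ε ^ 2 * exp (-M) / K ^ 5 ≤ ε ^ 2 * exp (-M) / Real.sqrt M :=
        div_le_div_of_nonneg_left hs.le hsq0 hsqK
    _ = 1 * (ε ^ 2 * exp (-M)) / Real.sqrt M := by ring
    _ < 3133 / 2500 * (ε ^ 2 * exp (-M)) / Real.sqrt M := by gcongr; norm_num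

end Member

end Literature.Analysis.FluidPDE.Tao2016AveragedNS
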